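import Summits.AtomisticToContinuum.BoseEinsteinCondensation.Theorems.PuffFloor.Negative.SmoothClassInhabitants
import Summits.AtomisticToContinuum.BoseEinsteinCondensation.Theorems.BECPhaseQuadratureSumRuleSumRuleChainGlueEnergy
import HarnessLib

/-!
# Every bounded admissible profile lies below ONE smooth-class potential
# (worker stub `stub_smoothDominant`, line `domination-order-reversal`,
# crux `BECConjugateDomination.HardCoreExtension`, stmt-AtomisticToContinuum-11786)

The line proves the crux by DOMINATION: a repulsive finite-range profile `v` that is bounded on
`[0, ∞)` (`v r ≤ M` for `0 ≤ r`, `v r = 0` for `r > R₀`) is put pointwise (on `[0, ∞)`) below one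
potential `w` of the SMOOTH CLASS (repulsive finite range, finite, `C²` as `x ↦ w(|x|)` on `ℝ³`,
edge condition `‖D²w̃‖ ≤ Cₑ √w̃`); an antitone comparison of condensate numbers (another stub, not
used here) then transfers BEC from `w` to `v`.

WITNESS: with `R := max R₀ 0`, `a := R + 1` and the flat glue `g = expNegInvGlue`,

  `w r = T · solidBump a r = T · g(a² - r²)`,   `T := M / g(a² - R²)`.

Class membership is `smoothClass_smul` (closure of the class under `v ↦ T·v`, `0 ≤ T`) applied to
`solidBump_mem_smoothClass`; domination on `0 ≤ r ≤ R` is monotonicity of `g`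
(`g(a² - R²) ≤ g(a² - r²)`, so `T · g(a² - r²) ≥ T · g(a² - R²) = M ≥ v r`), and for `r > R ≥ R₀`
both sides vanish (`v r = 0`).

All `[folklore]`; no Theses statement is asserted.
-/

noncomputable section

namespace Summit.AtomisticToContinuum.BoseEinsteinCondensation.Cruxes.HardCoreExtension.DominationOrderReversal

open Literature.MathematicalPhysics.QuantumManyBody.BoseGas
open Filter MeasureTheory
open scoped ENNReal NNReal Topology
open Summit.AtomisticToContinuum.BoseEinsteinCondensation.Theorems.PuffFloor.Negative
open Summit.AtomisticToContinuum.BoseEinsteinCondensation.Theorems.SumRuleChainGlue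

/-- On the core `0 ≤ r ≤ R` the solid bump of range `a` is at least its value "at radius `R`":
`g(a² - R²) ≤ solidBump a r = g(a² - r²)`, by monotonicity of the flat glue `g`. [folklore] -/
theorem ofReal_expNegInvGlue_le_solidBump {a R r : ℝ} (h0 : 0 ≤ r) (hr : r ≤ R) :
    ENNReal.ofReal (expNegInvGlue (a ^ 2 - R ^ 2)) ≤ solidBump a r := by
  change ENNReal.ofReal (expNegInvGlue (a ^ 2 - R ^ 2)) ≤
    ENNReal.ofReal (expNegInvGlue (a ^ 2 - r ^ 2))
  exact ENNReal.ofReal_le_ofReal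
    (expNegInvGlue.monotone (sub_le_sub_left (pow_le_pow_left₀ h0 hr 2) (a ^ 2)))

/-- **Stub 2 of line `domination-order-reversal` — SMOOTH DOMINANT.** Every repulsive finite-range
profile `v` bounded on `[0, ∞)` lies, on `[0, ∞)`, pointwise below a smooth-class potential `w`
(repulsive finite range, finite, `C²` as `x ↦ w(|x|)` on `ℝ³`, edge condition `‖D²w̃‖ ≤ Cₑ √w̃`);
namely `w = T · solidBump (R + 1)` with `R = max R₀ 0` (`R₀` a range of `v`) and
`T = M / expNegInvGlue ((R + 1)² - R²)` (`M` a bound of `v` on `[0, ∞)`). [folklore] -/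
theorem stub_smoothDominant :
    ∀ v : ℝ → ℝ≥0∞, IsRepulsiveFiniteRange v → (∃ M : ℝ≥0, ∀ r, 0 ≤ r → v r ≤ M) →
      ∃ w : ℝ → ℝ≥0∞,
        (IsRepulsiveFiniteRange w ∧ (∀ r, w r ≠ ⊤) ∧ ContDiff ℝ 2 (fun x : Space => (w ‖x‖).toReal) ∧
          ∃ Cₑ : ℝ, ∀ x : Space,
            ‖iteratedFDeriv ℝ 2 (fun x : Space => (w ‖x‖).toReal) x‖ ≤ Cₑ * Real.sqrt ((w ‖x‖).toReal)) ∧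
        ∀ r, 0 ≤ r → v r ≤ w r := by
  intro v hv hM
  obtain ⟨M, hM⟩ := hM
  -- a non-negative range `R` of `v`
  obtain ⟨R, hR0, hR⟩ : ∃ R : ℝ, 0 ≤ R ∧ ∀ r, R < r → v r = 0 := by
    obtain ⟨-, R₀, hR₀⟩ := hv
    exact ⟨max R₀ 0, le_max_right _ _, fun r hr => hR₀ r (lt_of_le_of_lt (le_max_left _ _) hr)⟩
  -- the core value `g(a² - R²) > 0` of the bump of range `a = R + 1`
  have ha : 0 < R + 1 := by linarith
  have hm : 0 < expNegInvGlue ((R + 1) ^ 2 - R ^ 2) := expNegInvGlue.pos_of_pos (by nlinarith)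
  have hT : 0 ≤ (M : ℝ) / expNegInvGlue ((R + 1) ^ 2 - R ^ 2) := div_nonneg M.coe_nonneg hm.le
  obtain ⟨hb1, hb2, hb3, hb4, -, -⟩ := solidBump_mem_smoothClass ha
  refine ⟨fun r => ENNReal.ofReal ((M : ℝ) / expNegInvGlue ((R + 1) ^ 2 - R ^ 2)) * solidBump (R + 1) r,
    smoothClass_smul hb1 hb2 hb3 hb4 hT, fun r hr => ?_⟩
  rcases le_or_gt r R with hrR | hrR
  · -- on the core: `v r ≤ M = T · g(a² - R²) ≤ T · g(a² - r²)`
    calc v r ≤ (M : ℝ≥0∞) := hM r hr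
      _ = ENNReal.ofReal ((M : ℝ) / expNegInvGlue ((R + 1) ^ 2 - R ^ 2) *
            expNegInvGlue ((R + 1) ^ 2 - R ^ 2)) := by
          rw [div_mul_cancel₀ _ hm.ne', ENNReal.ofReal_coe_nnreal]
      _ = ENNReal.ofReal ((M : ℝ) / expNegInvGlue ((R + 1) ^ 2 - R ^ 2)) *
            ENNReal.ofReal (expNegInvGlue ((R + 1) ^ 2 - R ^ 2)) := ENNReal.ofReal_mul hT
      _ ≤ ENNReal.ofReal ((M : ℝ) / expNegInvGlue ((R + 1) ^ 2 - R ^ 2)) * solidBump (R + 1) r :=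
          mul_le_mul_right (ofReal_expNegInvGlue_le_solidBump hr hrR) _
  · -- beyond the range of `v`: `v r = 0`
    rw [hR r hrR]
    exact zero_le

end Summit.AtomisticToContinuum.BoseEinsteinCondensation.Cruxes.HardCoreExtension.DominationOrderReversal

end
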